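import Summits.CriticalPhenomena.PercolationContinuityZ3.Theorems.PercNearOneGluingNoHeavyLowerTailAntitheticCyclePlusLengths
import Summits.CriticalPhenomena.PercolationContinuityZ3.Theorems.PercNearOneGluingNoHeavyLowerTailAntitheticPeelTools
import HarnessLib

/-!
# `NoHeavyLowerTail` (stmt-CriticalPhenomena-4575) — antithetic cluster pairs: THEOREM C′, REGROUPING THE BULK of the change family into classes
# (prim-hp-2 gen 42; HOME/THEOREM-Cprime-delta2-cycle.md §3, §12 (L3d))

Support file (`--supports stmt-CriticalPhenomena-4575`, hull-port prover `prim-hp-2`, gen 42).  No definitions, no named facts, no sorries; standard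
axioms.  (Run lengths `Cyc.Bulk.iLen/jLen` and the flip facts: …CyclePlusLengths.)

For the cycle `v 0 = s, …, v (n−1)` with `E₀ = Cyc.edgeSet n v`, two cycle vertices `y = v p`, `z = v q` (`0 < p, q < n`), two pairs `e, f ∉ E₀` and
`R ∌ s`, the half change family of THEOREM C′ is indexed by
  `𝒟 = {ω ∈ tset_{E₀}(R, ∅) : e ∈ ω, f ∉ ω, ¬(y red-reached ∧ z blue-reached)}`   (…AntitheticChangeCube `Change.sum_half_eq`).
A colouring is BULK if `iLen ω + jLen ω + 2 ≤ n`.  This file proves: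
* `Cyc.Bulk.sum_bulk_eq` — **regrouping**: `Σ_{ω ∈ 𝒟, bulk} Φ ω = Σ_{ω ∈ 𝒟, bulk, rr} [Φ ω + [kept]Φ(φ₂ ω) + [kept]Φ(φ₁ ω) + Φ(φ₁ φ₂ ω)]` for every `Φ`;
* `Cyc.Bulk.sum_bulk_nonneg` — hence, by `Cyc.Bulk.quad_nonneg`, the bulk part of the half change sum is `≥ 0` for monotone `F, G`.
[cite: VandenbergHaggstromKahn2005, §1 p. 3 (open cluster `C_s`)]
-/

noncomputable section

namespace Summit.CriticalPhenomena.PercolationContinuityZ3.Theorems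

open Literature.Probability.Percolation
open scoped Classical symmDiff

namespace Antithetic

namespace Cyc

namespace Bulk

variable {V : Type*} {n : ℕ} {v : ℕ → V}

section Regroup

variable [Fintype V] (hn : 3 ≤ n) (hinj : ∀ i j, i < n → j < n → v i = v j → i = j) (hper : v n = v 0)
include hn hinj hper

omit [Fintype V] in
/-- In an `rr` bulk colouring no vertex other than `s` is blue-reached; in particular the mixed-pair constraint holds. [this work] -/
theorem kept_of_rr {ω : Set (Sym2 V)} (h0 : edge v 0 ∈ ω) (h1 : edge v (n - 1) ∈ ω) (hB : iLen n v ω + jLen n v ω + 2 ≤ n) {p q : ℕ}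
    (hq0 : 0 < q) (hqn : q < n) :
    ¬ ((openGraph (ω ∩ edgeSet n v)).Reachable (v 0) (v p) ∧ (openGraph (ωᶜ ∩ edgeSet n v)).Reachable (v 0) (v q)) := by
  rintro ⟨-, hz⟩
  have hcw : ω ∈ cwRun n v True (iLen n v ω) := (cwRun_congr (iff_true_intro h0) ω).1 (cwRun_iLen ω)
  have hccw : ω ∈ ccwRun n v True (jLen n v ω) := (ccwRun_congr (iff_true_intro h1) ω).1 (ccwRun_jLen ω)
  have hcl := (clusters_rr hn hinj hper hcw hccw (one_le_iLen ω (by omega)) (one_le_jLen ω (by omega)) hB).2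
  rw [reach_iff_seen, hcl] at hz
  rcases hz with h | ⟨g, hg, -⟩
  · exact absurd (hinj q 0 hqn (by omega) h) (by omega)
  · exact hg

/-- **Regrouping the bulk.**  With `𝒟 = {ω ∈ tset_{E₀}(R,∅) : e ∈ ω, f ∉ ω, kept ω}` (`kept ω = ¬(y red-reached ∧ z blue-reached)`, `y = v p`, `z = v q`),
the sum of any `Φ` over the bulk colourings of `𝒟` equals the sum over the `rr` bulk colourings of `𝒟` of
`Φ ω + [kept (φ₂ ω)]·Φ (φ₂ ω) + [kept (φ₁ ω)]·Φ (φ₁ ω) + Φ (φ₂ (φ₁ ω))`, `φ₂ = · ∆ sufBlock (jLen ·)`, `φ₁ = · ∆ preBlock (iLen ·)`. [this work] -/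
theorem sum_bulk_eq (R : Set V) (hRs : v 0 ∉ R) {p q : ℕ} (hp0 : 0 < p) (hpn : p < n) (hq0 : 0 < q) (hqn : q < n) {e f : Sym2 V}
    (he : e ∉ edgeSet n v)
    (hf : f ∉ edgeSet n v) (Φ : Set (Sym2 V) → ℝ) :
    let kept : Set (Sym2 V) → Prop := fun ω =>
      ¬ ((openGraph (ω ∩ edgeSet n v)).Reachable (v 0) (v p) ∧ (openGraph (ωᶜ ∩ edgeSet n v)).Reachable (v 0) (v q))
    let D : Finset (Set (Sym2 V)) := (Peel.tset (edgeSet n v) (v 0) R ∅).filter (fun ω => e ∈ ω ∧ f ∉ ω ∧ kept ω)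
    let bulk : Set (Sym2 V) → Prop := fun ω => iLen n v ω + jLen n v ω + 2 ≤ n
    ∑ ω ∈ D.filter bulk, Φ ω =
      ∑ ω ∈ D.filter (fun ω => bulk ω ∧ edge v 0 ∈ ω ∧ edge v (n - 1) ∈ ω),
        (Φ ω + (if kept (ω ∆ sufBlock n v (jLen n v ω)) then Φ (ω ∆ sufBlock n v (jLen n v ω)) else 0) +
          (if kept (ω ∆ preBlock v (iLen n v ω)) then Φ (ω ∆ preBlock v (iLen n v ω)) else 0) +
          Φ ((ω ∆ preBlock v (iLen n v ω)) ∆ sufBlock n v (jLen n v ω))) := by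
  intro kept D bulk
  -- membership in D in usable form
  have memD : ∀ ω, ω ∈ D ↔ ω ∈ Peel.tset (edgeSet n v) (v 0) R ∅ ∧ e ∈ ω ∧ f ∉ ω ∧ kept ω := fun ω => by
    simp only [D, Finset.mem_filter]
  -- the two flips as functions of the colouring
  set φ₂ : Set (Sym2 V) → Set (Sym2 V) := fun ω => ω ∆ sufBlock n v (jLen n v ω) with hφ₂
  set φ₁ : Set (Sym2 V) → Set (Sym2 V) := fun ω => ω ∆ preBlock v (iLen n v ω) with hφ₁
  -- basic facts on bulk colourings
  have F2 : ∀ ω, bulk ω → bulk (φ₂ ω) ∧ iLen n v (φ₂ ω) = iLen n v ω ∧ jLen n v (φ₂ ω) = jLen n v ω ∧ φ₂ (φ₂ ω) = ω ∧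
      (edge v 0 ∈ φ₂ ω ↔ edge v 0 ∈ ω) ∧ (edge v (n - 1) ∈ φ₂ ω ↔ edge v (n - 1) ∉ ω) ∧ (e ∈ φ₂ ω ↔ e ∈ ω) ∧ (f ∈ φ₂ ω ↔ f ∈ ω) := by
    intro ω hB
    have hi := iLen_flip₂ hn hinj hper ω hB
    have hj := jLen_flip₂ hn hinj hper ω hB
    refine ⟨?_, hi, hj, ?_, edge_zero_flip₂ hn hinj hper ω hB, edge_last_flip₂ hn hinj hper ω hB,
      mem_flip_sufBlock_of_notMem ω he (by omega), mem_flip_sufBlock_of_notMem ω hf (by omega)⟩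
    · show iLen n v (φ₂ ω) + jLen n v (φ₂ ω) + 2 ≤ n
      rw [hi, hj]; exact hB
    · show (ω ∆ sufBlock n v (jLen n v ω)) ∆ sufBlock n v (jLen n v (ω ∆ sufBlock n v (jLen n v ω))) = ω
      rw [hj]; exact symmDiff_symmDiff_self ω _
  have F1 : ∀ ω, bulk ω → bulk (φ₁ ω) ∧ iLen n v (φ₁ ω) = iLen n v ω ∧ jLen n v (φ₁ ω) = jLen n v ω ∧ φ₁ (φ₁ ω) = ω ∧
      (edge v 0 ∈ φ₁ ω ↔ edge v 0 ∉ ω) ∧ (edge v (n - 1) ∈ φ₁ ω ↔ edge v (n - 1) ∈ ω) ∧ (e ∈ φ₁ ω ↔ e ∈ ω) ∧ (f ∈ φ₁ ω ↔ f ∈ ω) := by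
    intro ω hB
    have hi := iLen_flip₁ hn hinj hper ω hB
    have hj := jLen_flip₁ hn hinj hper ω hB
    refine ⟨?_, hi, hj, ?_, edge_zero_flip₁ hn hinj hper ω hB, edge_last_flip₁ hn hinj hper ω hB,
      mem_flip_preBlock_of_notMem ω he (by omega), mem_flip_preBlock_of_notMem ω hf (by omega)⟩
    · show iLen n v (φ₁ ω) + jLen n v (φ₁ ω) + 2 ≤ n
      rw [hi, hj]; exact hB
    · show (ω ∆ preBlock v (iLen n v ω)) ∆ preBlock v (iLen n v (ω ∆ preBlock v (iLen n v ω))) = ω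
      rw [hi]; exact symmDiff_symmDiff_self ω _
  have comm : ∀ ω, bulk ω → φ₂ (φ₁ ω) = φ₁ (φ₂ ω) := by
    intro ω hB
    show (ω ∆ preBlock v (iLen n v ω)) ∆ sufBlock n v (jLen n v (ω ∆ preBlock v (iLen n v ω))) =
      (ω ∆ sufBlock n v (jLen n v ω)) ∆ preBlock v (iLen n v (ω ∆ sufBlock n v (jLen n v ω)))
    rw [(F1 ω hB).2.2.1, (F2 ω hB).2.1, symmDiff_right_comm]
  -- split the bulk by the colours of the two s-pairs
  set S := D.filter bulk with hS
  have split : ∑ ω ∈ S, Φ ω = ∑ ω ∈ S.filter (fun ω => edge v 0 ∈ ω ∧ edge v (n - 1) ∈ ω), Φ ω +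
      ∑ ω ∈ S.filter (fun ω => edge v 0 ∈ ω ∧ edge v (n - 1) ∉ ω), Φ ω +
      ∑ ω ∈ S.filter (fun ω => edge v 0 ∉ ω ∧ edge v (n - 1) ∈ ω), Φ ω +
      ∑ ω ∈ S.filter (fun ω => edge v 0 ∉ ω ∧ edge v (n - 1) ∉ ω), Φ ω := by
    rw [← Finset.sum_filter_add_sum_filter_not S (fun ω => edge v 0 ∈ ω),
      ← Finset.sum_filter_add_sum_filter_not (S.filter fun ω => edge v 0 ∈ ω) (fun ω => edge v (n - 1) ∈ ω),
      ← Finset.sum_filter_add_sum_filter_not (S.filter fun ω => edge v 0 ∉ ω) (fun ω => edge v (n - 1) ∈ ω)]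
    simp only [Finset.filter_filter]
    ring
  -- the rr class set
  set RR := D.filter (fun ω => bulk ω ∧ edge v 0 ∈ ω ∧ edge v (n - 1) ∈ ω) with hRR
  have hRR' : S.filter (fun ω => edge v 0 ∈ ω ∧ edge v (n - 1) ∈ ω) = RR := by
    rw [hS, Finset.filter_filter]
  have memS : ∀ ω, ω ∈ S ↔ ω ∈ D ∧ bulk ω := fun ω => by rw [hS, Finset.mem_filter]
  have memRR : ∀ ω, ω ∈ RR ↔ ω ∈ D ∧ bulk ω ∧ edge v 0 ∈ ω ∧ edge v (n - 1) ∈ ω := fun ω => by rw [hRR, Finset.mem_filter]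
  -- generic transport lemma: a flip ψ that is an involution on bulk colourings, preserves bulk/e/f/tset, maps RR onto a colour class
  -- (rb)
  have rb : ∑ ω ∈ S.filter (fun ω => edge v 0 ∈ ω ∧ edge v (n - 1) ∉ ω), Φ ω = ∑ ω ∈ RR, (if kept (φ₂ ω) then Φ (φ₂ ω) else 0) := by
    rw [← Finset.sum_filter]
    symm
    refine Finset.sum_nbij' φ₂ φ₂ (fun ω hω => ?_) (fun ω hω => ?_) (fun ω hω => ?_) (fun ω hω => ?_) (fun ω _ => rfl)
    · rw [Finset.mem_filter, memRR] at hω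
      obtain ⟨⟨hD, hB, h0, h1⟩, hk⟩ := hω
      obtain ⟨hB2, -, -, -, e0, e1, ee, ef⟩ := F2 ω hB
      rw [memD] at hD
      rw [Finset.mem_filter, memS, memD]
      exact ⟨⟨⟨mem_tset_of_bulk hn hinj hper _ R hRs hB2, ee.2 hD.2.1, fun h => hD.2.2.1 (ef.1 h), hk⟩, hB2⟩, e0.2 h0, fun h => (e1.1 h) h1⟩
    · rw [Finset.mem_filter, memS, memD] at hω
      obtain ⟨⟨⟨-, heω, hfω, hk⟩, hB⟩, h0, h1⟩ := hω
      obtain ⟨hB2, -, -, inv, e0, e1, ee, ef⟩ := F2 ω hB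
      rw [Finset.mem_filter, memRR, memD]
      refine ⟨⟨⟨mem_tset_of_bulk hn hinj hper _ R hRs hB2, ee.2 heω, fun h => hfω (ef.1 h), ?_⟩, hB2, e0.2 h0, e1.2 h1⟩, ?_⟩
      · exact kept_of_rr hn hinj hper (e0.2 h0) (e1.2 h1) hB2 hq0 hqn
      · show kept (φ₂ (φ₂ ω)); rw [inv]; exact hk
    · rw [Finset.mem_filter, memRR] at hω
      exact (F2 ω hω.1.2.1).2.2.2.1
    · rw [Finset.mem_filter, memS] at hω
      exact (F2 ω hω.1.2).2.2.2.1
  -- (br)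
  have br : ∑ ω ∈ S.filter (fun ω => edge v 0 ∉ ω ∧ edge v (n - 1) ∈ ω), Φ ω = ∑ ω ∈ RR, (if kept (φ₁ ω) then Φ (φ₁ ω) else 0) := by
    rw [← Finset.sum_filter]
    symm
    refine Finset.sum_nbij' φ₁ φ₁ (fun ω hω => ?_) (fun ω hω => ?_) (fun ω hω => ?_) (fun ω hω => ?_) (fun ω _ => rfl)
    · rw [Finset.mem_filter, memRR] at hω
      obtain ⟨⟨hD, hB, h0, h1⟩, hk⟩ := hω
      obtain ⟨hB1, -, -, -, e0, e1, ee, ef⟩ := F1 ω hB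
      rw [memD] at hD
      rw [Finset.mem_filter, memS, memD]
      exact ⟨⟨⟨mem_tset_of_bulk hn hinj hper _ R hRs hB1, ee.2 hD.2.1, fun h => hD.2.2.1 (ef.1 h), hk⟩, hB1⟩, fun h => (e0.1 h) h0, e1.2 h1⟩
    · rw [Finset.mem_filter, memS, memD] at hω
      obtain ⟨⟨⟨-, heω, hfω, hk⟩, hB⟩, h0, h1⟩ := hω
      obtain ⟨hB1, -, -, inv, e0, e1, ee, ef⟩ := F1 ω hB
      rw [Finset.mem_filter, memRR, memD]
      refine ⟨⟨⟨mem_tset_of_bulk hn hinj hper _ R hRs hB1, ee.2 heω, fun h => hfω (ef.1 h), ?_⟩, hB1, e0.2 h0, e1.2 h1⟩, ?_⟩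
      · exact kept_of_rr hn hinj hper (e0.2 h0) (e1.2 h1) hB1 hq0 hqn
      · show kept (φ₁ (φ₁ ω)); rw [inv]; exact hk
    · rw [Finset.mem_filter, memRR] at hω
      exact (F1 ω hω.1.2.1).2.2.2.1
    · rw [Finset.mem_filter, memS] at hω
      exact (F1 ω hω.1.2).2.2.2.1
  -- (bb)
  have inv12 : ∀ ω, bulk ω → φ₂ (φ₁ (φ₂ (φ₁ ω))) = ω := by
    intro ω hB
    have hB2 := (F2 ω hB).1
    calc φ₂ (φ₁ (φ₂ (φ₁ ω))) = φ₂ (φ₁ (φ₁ (φ₂ ω))) := by rw [comm ω hB]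
      _ = φ₂ (φ₂ ω) := by rw [(F1 (φ₂ ω) hB2).2.2.2.1]
      _ = ω := (F2 ω hB).2.2.2.1
  have e12 : ∀ ω, bulk ω → φ₂ (φ₁ ω) = (ω ∆ preBlock v (iLen n v ω)) ∆ sufBlock n v (jLen n v ω) := by
    intro ω hB
    show (ω ∆ preBlock v (iLen n v ω)) ∆ sufBlock n v (jLen n v (ω ∆ preBlock v (iLen n v ω))) = _
    rw [(F1 ω hB).2.2.1]
  have bb : ∑ ω ∈ S.filter (fun ω => edge v 0 ∉ ω ∧ edge v (n - 1) ∉ ω), Φ ω = ∑ ω ∈ RR, Φ (φ₂ (φ₁ ω)) := by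
    symm
    refine Finset.sum_nbij' (fun ω => φ₂ (φ₁ ω)) (fun ω => φ₂ (φ₁ ω)) (fun ω hω => ?_) (fun ω hω => ?_) (fun ω hω => ?_)
      (fun ω hω => ?_) (fun ω _ => rfl)
    · rw [memRR] at hω
      obtain ⟨hD, hB, h0, h1⟩ := hω
      obtain ⟨hB1, -, -, -, e0, e1, ee, ef⟩ := F1 ω hB
      obtain ⟨hB12, -, -, -, e0', e1', ee', ef'⟩ := F2 (φ₁ ω) hB1
      rw [memD] at hD
      rw [Finset.mem_filter, memS, memD]
      refine ⟨⟨⟨mem_tset_of_bulk hn hinj hper _ R hRs hB12, ee'.2 (ee.2 hD.2.1), fun h => hD.2.2.1 (ef.1 (ef'.1 h)), ?_⟩, hB12⟩,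
        fun h => (e0.1 (e0'.1 h)) h0, fun h => (e1'.1 h) (e1.2 h1)⟩
      -- kept for the bb colouring: its red cluster is empty, so y = v p (p ≠ 0) is not red-reached
      rintro ⟨hy, -⟩
      have hcw : ω ∈ cwRun n v True (iLen n v ω) := (cwRun_congr (iff_true_intro h0) ω).1 (cwRun_iLen ω)
      have hccw : ω ∈ ccwRun n v True (jLen n v ω) := (ccwRun_congr (iff_true_intro h1) ω).1 (ccwRun_jLen ω)
      have hcl := (clusters_bb hn hinj hper hcw hccw (one_le_iLen ω (by omega)) (one_le_jLen ω (by omega)) hB).1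
      rw [e12 ω hB, reach_iff_seen, hcl] at hy
      rcases hy with h | ⟨g, hg, -⟩
      · exact absurd (hinj p 0 hpn (by omega) h) (by omega)
      · exact hg
    · rw [Finset.mem_filter, memS, memD] at hω
      obtain ⟨⟨⟨-, heω, hfω, hk⟩, hB⟩, h0, h1⟩ := hω
      obtain ⟨hB1, -, -, -, e0, e1, ee, ef⟩ := F1 ω hB
      obtain ⟨hB12, -, -, -, e0', e1', ee', ef'⟩ := F2 (φ₁ ω) hB1
      have H0 : edge v 0 ∈ φ₂ (φ₁ ω) := e0'.2 (e0.2 h0)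
      have H1 : edge v (n - 1) ∈ φ₂ (φ₁ ω) := e1'.2 (fun h => h1 (e1.1 h))
      rw [memRR, memD]
      exact ⟨⟨mem_tset_of_bulk hn hinj hper _ R hRs hB12, ee'.2 (ee.2 heω), fun h => hfω (ef.1 (ef'.1 h)),
        kept_of_rr hn hinj hper H0 H1 hB12 hq0 hqn⟩, hB12, H0, H1⟩
    · rw [memRR] at hω
      exact inv12 ω hω.2.1
    · rw [Finset.mem_filter, memS] at hω
      exact inv12 ω hω.1.2
  rw [split, hRR', rb, br, bb, ← Finset.sum_add_distrib, ← Finset.sum_add_distrib, ← Finset.sum_add_distrib]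
  refine Finset.sum_congr rfl fun ω hω => ?_
  rw [memRR] at hω
  rw [e12 ω hω.2.1]

/-- **The bulk part of the half change sum is nonnegative** (THEOREM C′, bulk): for monotone `F, G`, cycle vertices `y = v p`, `z = v q` other than `s`,
markers `e, f` off the cycle and `R ∌ s`. [this work] -/
theorem sum_bulk_nonneg (R : Set V) (hRs : v 0 ∉ R) {p q : ℕ} (hp0 : 0 < p) (hpn : p < n) (hq0 : 0 < q) (hqn : q < n) {e f : Sym2 V}
    (he : e ∉ edgeSet n v) (hf : f ∉ edgeSet n v) {F G : Set (Sym2 V) → ℝ} (hF : Monotone F) (hG : Monotone G) :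
    let kept : Set (Sym2 V) → Prop := fun ω =>
      ¬ ((openGraph (ω ∩ edgeSet n v)).Reachable (v 0) (v p) ∧ (openGraph (ωᶜ ∩ edgeSet n v)).Reachable (v 0) (v q))
    let D : Finset (Set (Sym2 V)) := (Peel.tset (edgeSet n v) (v 0) R ∅).filter (fun ω => e ∈ ω ∧ f ∉ ω ∧ kept ω)
    let bulk : Set (Sym2 V) → Prop := fun ω => iLen n v ω + jLen n v ω + 2 ≤ n
    0 ≤ ∑ ω ∈ D.filter bulk,
      (F (Pendant.liftSet (v 0) (v p) e (openEdgeCluster (ω ∩ edgeSet n v) (v 0))) -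
          F (Pendant.liftSet (v 0) (v q) f (openEdgeCluster (ωᶜ ∩ edgeSet n v) (v 0)))) *
        (G (Pendant.liftSet (v 0) (v p) e (openEdgeCluster (ω ∩ edgeSet n v) (v 0))) -
          G (Pendant.liftSet (v 0) (v q) f (openEdgeCluster (ωᶜ ∩ edgeSet n v) (v 0)))) := by
  intro kept D bulk
  rw [sum_bulk_eq hn hinj hper R hRs hp0 hpn hq0 hqn he hf]
  refine Finset.sum_nonneg fun ω hω => ?_
  rw [Finset.mem_filter] at hω
  obtain ⟨-, hB, h0, h1⟩ := hω
  have hcw : ω ∈ cwRun n v True (iLen n v ω) := (cwRun_congr (iff_true_intro h0) ω).1 (cwRun_iLen ω)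
  have hccw : ω ∈ ccwRun n v True (jLen n v ω) := (ccwRun_congr (iff_true_intro h1) ω).1 (ccwRun_jLen ω)
  exact quad_nonneg hn hinj hper hF hG hp0 hpn hq0 hqn e f hcw hccw (one_le_iLen ω (by omega)) (one_le_jLen ω (by omega)) hB

end Regroup

end Bulk

end Cyc

end Antithetic

end Summit.CriticalPhenomena.PercolationContinuityZ3.Theorems
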